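import Summits.QuantumFields.BalabanUV.T4Continuum.Support.NE7K1LinFineOpBilinWeight
import Summits.QuantumFields.BalabanUV.T4Continuum.Support.NE7K1LinTwoRunKit

/-!
# NE7K1LinRunBWeight — row NE7 (node U5), candidate route HOM, path H1L, cell K1-lin(s), U = 1 instance of (π6): run B's block
# operator `H_B = L^{−(d+1)}·Tᵀ·fineOpR(nL) a 0 R′·T` at a GENERAL BLOCK-CONSTANT WEIGHT — coercivity, the quadratic conjugation
# error `≥ −κ_B‖·‖²`, and the BILINEAR conjugation error bounded FORM-RELATIVELY, all `η`-free

Lineage `b2b-balaban-t4-ne7-p2` (CRUX PROVER NE7 #2), generation 64.  For a coarse weight `θ` on `R = R′.image (blk L)` with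
`|θ x − θ y| ≤ δ∕n` across coarse bonds and `≤ Θ` inside coarse `n`-blocks, the block-coordinate weight `ρ = θ ∘ site` is compatible
with the fine weight `ρ′ = θ ∘ rblk` under `T` (`NE7K1LinBlockCoords.coordT_compat`), and `ρ′` oscillates by `≤ (δL)·(1∕(nL))` across
fine bonds and by `≤ Θ` inside `nL`-blocks; so every conjugation statement about `fineOpR (nL) a 0 R′` transfers to `H_B` by
congruence (`NE7K1LinSchurLineCoords`), with `L^{−(d+1)}·‖T·‖² ≤ (L^{d+1}+1)∕L^{d+1} ≤ 2`.  [folklore]: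
* `dot_conjW_mulVec`, **`bilin_conjW_congr`** (bilinear covariance: `err_ρ(c·TᵀMT; v, v′) = c·err_{ρ′}(M; Tv, Tv′)`);
* `fine_weight_bond ∕ _block` (the oscillation of `θ ∘ rblk`); `runB_coercive` (`(min(2,a)∕L^{d+1})‖u‖² ≤ ⟨u,H_Bu⟩`);
* **`runB_conjError_ge`**: `−κ_B‖u‖² ≤ ⟨u,(conjW ρ H_B)u⟩ − ⟨u,H_Bu⟩`, `κ_B = L^{−(d+1)}(2(d+1)(δL)² + a(e^Θ−1))(L^{d+1}+1)`;
* **`runB_bilinError_le`**: `|⟨v,(conjW ρ H_B)v′⟩ − ⟨v,H_Bv′⟩| ≤ κ′(‖v‖√⟨v′,H_Bv′⟩ + ‖v′‖√⟨v,H_Bv⟩) + κ″‖v‖‖v′‖` with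
  `κ′ = L^{−(d+1)}√(2κ₁)√(L^{d+1}+1)√(L^{d+1})`, `κ″ = L^{−(d+1)}(κ₁ + a(e^Θ−1))(L^{d+1}+1)`, `κ₁ = 2(d+1)(δL)²` — no `n` anywhere.

HONEST FRAMING: [folklore] over the tree's `B4Lower18`; Gaussian (`A = 0`); nothing printed asserted; no `sorry`.  FIXED FINITE T⁴, rung
(B)+1; NE7 NOT PRINTED ∕ NOT PROVED; spine 0∕9; NOT infinite volume, NOT mass gap, NOT Clay.  HONEST DEPENDENCY: continuum YM on T⁴ ⇐
BetaPertH ∧ nine spine estimates (0/9 proved); BetaPertH ⇐ (D1) ∧ (D4) ∧ CAP+tail; G-an2-4 gates asym, D1 and NE2/3/4.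
-/

noncomputable section

open Finset Matrix

namespace Summit.QuantumFields.BalabanUV.T4Continuum.NE7K1LinRunBWeight

open Literature.MathematicalPhysics.QuantumFieldTheory.Balaban1983to89
open Literature.MathematicalPhysics.QuantumFieldTheory.Balaban1983to89.B4Reflection242
open Literature.MathematicalPhysics.QuantumFieldTheory.Balaban1983to89.B4BoxCov237
open Literature.MathematicalPhysics.QuantumFieldTheory.Balaban1983to89.B4Lower18
open Literature.MathematicalPhysics.QuantumFieldTheory.Balaban1983to89.B4Thm110ZeroBox (blk_blk)
open NE7K1LinSchurLineForm NE7K1LinSchurLineCoords NE7K1LinFineOpWeight NE7K1LinBlockCoords NE7K1LinSchurLineU1 NE7K1LinTwoRunKit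
open NE7K1LinConjW NE7K1LinBilinConjError NE7K1LinFineOpBilinWeight

/-! ### §1 Bilinear covariance under a weight-compatible congruence -/

section Congr

variable {ι κ : Type*} [Fintype ι] [Fintype κ]

omit [Fintype ι] in
/-- `⟨z,(conjW θ M)u⟩ = ⟨e^{θ}z, M(e^{−θ}u)⟩`. [folklore] -/
theorem dot_conjW_mulVec [Fintype ι] (θ : ι → ℝ) (M : Matrix ι ι ℝ) (z u : ι → ℝ) :
    z ⬝ᵥ (conjW θ M).mulVec u = (fun j => Real.exp (θ j) * z j) ⬝ᵥ M.mulVec (fun k => Real.exp (-θ k) * u k) := by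
  simp only [dotProduct, mulVec, conjW_apply, Finset.mul_sum]
  refine Finset.sum_congr rfl fun j _ => Finset.sum_congr rfl fun k _ => ?_
  rw [Real.exp_sub, Real.exp_neg]
  have hk : Real.exp (θ k) ≠ 0 := (Real.exp_pos _).ne'
  field_simp

/-- **BILINEAR COVARIANCE OF THE CONJUGATION ERROR**: `err_ρ(c·TᵀMT; z, u) = c·err_{ρ′}(M; Tz, Tu)` for weight-compatible `T`.
[folklore] -/
theorem bilin_conjW_congr [DecidableEq ι] [DecidableEq κ] (T : Matrix κ ι ℝ) (M : Matrix κ κ ℝ) (c : ℝ) (ρ : ι → ℝ) (ρ' : κ → ℝ)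
    (hT : ∀ x j, T x j ≠ 0 → ρ' x = ρ j) (z u : ι → ℝ) :
    z ⬝ᵥ (conjW ρ (c • (Tᵀ * M * T))).mulVec u - z ⬝ᵥ (c • (Tᵀ * M * T)).mulVec u =
      c * (T.mulVec z ⬝ᵥ (conjW ρ' M).mulVec (T.mulVec u) - T.mulVec z ⬝ᵥ M.mulVec (T.mulVec u)) := by
  rw [dot_conjW_mulVec, dot_conjW_mulVec, dot_congr_mulVec, dot_congr_mulVec, ← mul_sub,
    mulVec_weight_of_compat T ρ ρ' hT (fun t => Real.exp t) z, mulVec_weight_of_compat T ρ ρ' hT (fun t => Real.exp (-t)) u]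

end Congr

/-! ### §2 Run B at a block-constant weight -/

section RunB

variable {d : ℕ} {n L : ℕ} [NeZero L] {R' : Finset (Fin (d + 1) → ℤ)}

/-- the fine weight `θ ∘ rblk` oscillates by `≤ (δL)·(1∕(nL))` across fine bonds when `θ` oscillates by `≤ δ∕n` across coarse
bonds. [folklore] -/
theorem fine_weight_bond (hn : 1 ≤ n) (θ : ↥(R'.image (blk L)) → ℝ) {δ : ℝ} (hδ0 : 0 ≤ δ)
    (hbond : ∀ x₁ x₂ : ↥(R'.image (blk L)), x₂.1 ∈ nbrs x₁.1 → |θ x₁ - θ x₂| ≤ δ * (1 / (n : ℝ)))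
    (x₁ x₂ : ↥R') (h12 : x₂.1 ∈ nbrs x₁.1) :
    |θ (rblk L R' x₁) - θ (rblk L R' x₂)| ≤ (δ * L) * (1 / ((n * L : ℕ) : ℝ)) := by
  have hL : 1 ≤ L := NeZero.one_le
  have hn0 : (0 : ℝ) < n := by exact_mod_cast hn
  have hL0 : (0 : ℝ) < L := by exact_mod_cast hL
  have hnL' : (δ * L) * (1 / ((n * L : ℕ) : ℝ)) = δ * (1 / (n : ℝ)) := by
    push_cast
    field_simp
  rw [hnL']
  by_cases heq : blk L x₂.1 = blk L x₁.1
  · have : rblk L R' x₂ = rblk L R' x₁ := Subtype.ext heq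
    rw [this, sub_self, abs_zero]; positivity
  · exact hbond (rblk L R' x₁) (rblk L R' x₂) (blk_nbr_mem_nbrs hL h12 heq)

omit [NeZero L] in
/-- the fine weight `θ ∘ rblk` oscillates by `≤ Θ` inside `nL`-blocks when `θ` oscillates by `≤ Θ` inside coarse `n`-blocks.
[folklore] -/
theorem fine_weight_block (θ : ↥(R'.image (blk L)) → ℝ) {Θ : ℝ}
    (hblock : ∀ x₁ x₂ : ↥(R'.image (blk L)), blk n x₁.1 = blk n x₂.1 → |θ x₁ - θ x₂| ≤ Θ)
    (x₁ x₂ : ↥R') (h12 : blk (n * L) x₁.1 = blk (n * L) x₂.1) :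
    |θ (rblk L R' x₁) - θ (rblk L R' x₂)| ≤ Θ := by
  refine hblock _ _ ?_
  show blk n (blk L x₁.1) = blk n (blk L x₂.1)
  rw [blk_blk, blk_blk, Nat.mul_comm]; exact h12

/-- **COERCIVITY OF RUN B**: `(min(2,a)∕L^{d+1})‖u‖² ≤ ⟨u, H_Bu⟩` (`a ≥ 0`, `n ≥ 1`). [folklore] -/
theorem runB_coercive (hn : 1 ≤ n) (hR' : IsBlockUnion (n * L) R') {a : ℝ} (ha : 0 ≤ a)
    (u : ↥(R'.image (blk L)) ⊕ (↥(R'.image (blk L)) × NZ d L) → ℝ) :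
    min 2 a / (L : ℝ) ^ (d + 1) * (u ⬝ᵥ u) ≤ u ⬝ᵥ (runB (isBlockUnion_fine hR') n a).mulVec u := by
  have hnL : 1 ≤ n * L := Nat.one_le_iff_ne_zero.2 (Nat.mul_ne_zero (Nat.one_le_iff_ne_zero.1 hn) (NeZero.ne L))
  have hmin : 0 ≤ min 2 a := le_min (by norm_num) ha
  have h := coercive_congr (coordT (isBlockUnion_fine hR')) (fineOpR (n * L) a 0 R') (c := ((L : ℝ) ^ (d + 1))⁻¹)
    (σM := min 2 a) (cT := 1) (by positivity) hmin (fun φ => lower18_zero hnL ha hR' φ) (dot_le_coordT _) u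
  have hσ' : ((L : ℝ) ^ (d + 1))⁻¹ * min 2 a * 1 = min 2 a / (L : ℝ) ^ (d + 1) := by
    rw [mul_one, inv_mul_eq_div]
  rw [hσ'] at h
  exact h

/-- **QUADRATIC CONJUGATION ERROR OF RUN B** at `ρ = θ ∘ site`: `−κ_B‖u‖² ≤ ⟨u,(conjW ρ H_B)u⟩ − ⟨u,H_Bu⟩`,
`κ_B = L^{−(d+1)}(2(d+1)(δL)² + a(e^Θ−1))(L^{d+1}+1)`. [folklore] -/
theorem runB_conjError_ge (hn : 1 ≤ n) (hR' : IsBlockUnion (n * L) R') {a δ Θ : ℝ} (ha : 0 ≤ a) (hδ0 : 0 ≤ δ) (hδ1 : δ ≤ 1)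
    (hΘ0 : 0 ≤ Θ) (θ : ↥(R'.image (blk L)) → ℝ)
    (hbond : ∀ x₁ x₂ : ↥(R'.image (blk L)), x₂.1 ∈ nbrs x₁.1 → |θ x₁ - θ x₂| ≤ δ * (1 / (n : ℝ)))
    (hblock : ∀ x₁ x₂ : ↥(R'.image (blk L)), blk n x₁.1 = blk n x₂.1 → |θ x₁ - θ x₂| ≤ Θ)
    (u : ↥(R'.image (blk L)) ⊕ (↥(R'.image (blk L)) × NZ d L) → ℝ) :
    -(((L : ℝ) ^ (d + 1))⁻¹ * (2 * ((d : ℝ) + 1) * (δ * L) ^ 2 + a * (Real.exp Θ - 1)) * ((L : ℝ) ^ (d + 1) + 1)) *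
        (u ⬝ᵥ u) ≤
      u ⬝ᵥ (conjW (fun c => θ (site c)) (runB (isBlockUnion_fine hR') n a)).mulVec u -
        u ⬝ᵥ (runB (isBlockUnion_fine hR') n a).mulVec u := by
  have hR'L : IsBlockUnion L R' := isBlockUnion_fine hR'
  have hnL : 1 ≤ n * L := Nat.one_le_iff_ne_zero.2 (Nat.mul_ne_zero (Nat.one_le_iff_ne_zero.1 hn) (NeZero.ne L))
  have hn0 : (0 : ℝ) < n := by exact_mod_cast hn
  have hexp : 0 ≤ Real.exp Θ - 1 := by linarith [Real.add_one_le_exp Θ]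
  have hcompat : ∀ x' c, coordT hR'L x' c ≠ 0 → θ (rblk L R' x') = θ (site c) := fun x' c h => by rw [coordT_compat hR'L x' c h]
  have hδn : (δ * L) * (1 / ((n * L : ℕ) : ℝ)) ≤ 1 := by
    have : (δ * L) * (1 / ((n * L : ℕ) : ℝ)) = δ * (1 / (n : ℝ)) := by
      have hL0 : (0 : ℝ) < L := by exact_mod_cast (NeZero.one_le : 1 ≤ L)
      push_cast; field_simp
    rw [this]
    calc δ * (1 / (n : ℝ)) ≤ 1 * 1 := mul_le_mul hδ1 (by rw [div_le_one hn0]; exact_mod_cast hn) (by positivity) zero_le_one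
      _ = 1 := one_mul 1
  have hM := conjError_fineOpR_ge hnL hR' ha hδn hΘ0 (fun x' => θ (rblk L R' x')) (fine_weight_bond hn θ hδ0 hbond)
    (fine_weight_block θ hblock)
  have h := conjError_congr_ge (coordT hR'L) (fineOpR (n * L) a 0 R') (c := ((L : ℝ) ^ (d + 1))⁻¹)
    (κM := 2 * ((d : ℝ) + 1) * (δ * L) ^ 2 + a * (Real.exp Θ - 1)) (CT := (L : ℝ) ^ (d + 1) + 1) (by positivity)
    (by nlinarith [mul_nonneg ha hexp, sq_nonneg (δ * L)]) (fun c => θ (site c)) (fun x' => θ (rblk L R' x')) hcompat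
    hM (coordT_le_dot hR'L) u
  rw [form_conjW_sub_eq]
  exact h

/-- **BILINEAR CONJUGATION ERROR OF RUN B, FORM-RELATIVE AND `η`-FREE** at `ρ = θ ∘ site`. [folklore] -/
theorem runB_bilinError_le (hn : 1 ≤ n) (hR' : IsBlockUnion (n * L) R') {a δ Θ : ℝ} (ha : 0 ≤ a) (hδ0 : 0 ≤ δ) (hδ1 : δ ≤ 1)
    (hΘ0 : 0 ≤ Θ) (θ : ↥(R'.image (blk L)) → ℝ)
    (hbond : ∀ x₁ x₂ : ↥(R'.image (blk L)), x₂.1 ∈ nbrs x₁.1 → |θ x₁ - θ x₂| ≤ δ * (1 / (n : ℝ)))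
    (hblock : ∀ x₁ x₂ : ↥(R'.image (blk L)), blk n x₁.1 = blk n x₂.1 → |θ x₁ - θ x₂| ≤ Θ)
    (v v' : ↥(R'.image (blk L)) ⊕ (↥(R'.image (blk L)) × NZ d L) → ℝ) :
    |v ⬝ᵥ (conjW (fun c => θ (site c)) (runB (isBlockUnion_fine hR') n a)).mulVec v' -
        v ⬝ᵥ (runB (isBlockUnion_fine hR') n a).mulVec v'| ≤
      ((L : ℝ) ^ (d + 1))⁻¹ * Real.sqrt (2 * (2 * ((d : ℝ) + 1) * (δ * L) ^ 2)) * Real.sqrt ((L : ℝ) ^ (d + 1) + 1) *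
          Real.sqrt ((L : ℝ) ^ (d + 1)) *
          (Real.sqrt (v ⬝ᵥ v) * Real.sqrt (v' ⬝ᵥ (runB (isBlockUnion_fine hR') n a).mulVec v') +
            Real.sqrt (v' ⬝ᵥ v') * Real.sqrt (v ⬝ᵥ (runB (isBlockUnion_fine hR') n a).mulVec v)) +
        ((L : ℝ) ^ (d + 1))⁻¹ * (2 * ((d : ℝ) + 1) * (δ * L) ^ 2 + a * (Real.exp Θ - 1)) * ((L : ℝ) ^ (d + 1) + 1) *
          (Real.sqrt (v ⬝ᵥ v) * Real.sqrt (v' ⬝ᵥ v')) := by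
  have hR'L : IsBlockUnion L R' := isBlockUnion_fine hR'
  have hnL : 1 ≤ n * L := Nat.one_le_iff_ne_zero.2 (Nat.mul_ne_zero (Nat.one_le_iff_ne_zero.1 hn) (NeZero.ne L))
  have hn0 : (0 : ℝ) < n := by exact_mod_cast hn
  have hL0 : (0 : ℝ) < L := by exact_mod_cast (NeZero.one_le : 1 ≤ L)
  have hLpow : (0 : ℝ) < (L : ℝ) ^ (d + 1) := by positivity
  have hexp : 0 ≤ Real.exp Θ - 1 := by linarith [Real.add_one_le_exp Θ]
  set c : ℝ := ((L : ℝ) ^ (d + 1))⁻¹ with hc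
  have hc0 : 0 ≤ c := by positivity
  set T := coordT hR'L with hT
  set M := fineOpR (n * L) a 0 R' with hM
  have hH : runB hR'L n a = c • (Tᵀ * M * T) := rfl
  have hcompat : ∀ x' cc, T x' cc ≠ 0 → θ (rblk L R' x') = θ (site cc) := fun x' cc h => by
    rw [hT] at h; rw [coordT_compat hR'L x' cc h]
  have hδn : (δ * L) * (1 / ((n * L : ℕ) : ℝ)) ≤ 1 := by
    have : (δ * L) * (1 / ((n * L : ℕ) : ℝ)) = δ * (1 / (n : ℝ)) := by push_cast; field_simp
    rw [this]
    calc δ * (1 / (n : ℝ)) ≤ 1 * 1 := mul_le_mul hδ1 (by rw [div_le_one hn0]; exact_mod_cast hn) (by positivity) zero_le_one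
      _ = 1 := one_mul 1
  -- covariance and the fine-lattice bilinear bound
  have herr := bilin_conjW_congr T M c (fun cc => θ (site cc)) (fun x' => θ (rblk L R' x')) hcompat v v'
  rw [← hH] at herr
  rw [herr, abs_mul, abs_of_nonneg hc0]
  have hfine := bilin_conjError_fineOpR_le hnL hR' ha hδn hΘ0 (fun x' => θ (rblk L R' x'))
    (fine_weight_bond hn θ hδ0 hbond) (fine_weight_block θ hblock) (T.mulVec v) (T.mulVec v')
  -- sizes: ‖Tw‖ ≤ √(L^{d+1}+1)‖w‖, ⟨Tw, M Tw⟩ = L^{d+1}⟨w, H_B w⟩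
  have nn : ∀ w : ↥(R'.image (blk L)) ⊕ (↥(R'.image (blk L)) × NZ d L) → ℝ, 0 ≤ w ⬝ᵥ w := fun w => by
    simp only [dotProduct]; exact Finset.sum_nonneg fun _ _ => mul_self_nonneg _
  have hTn : ∀ w : ↥(R'.image (blk L)) ⊕ (↥(R'.image (blk L)) × NZ d L) → ℝ,
      Real.sqrt (T.mulVec w ⬝ᵥ T.mulVec w) ≤ Real.sqrt ((L : ℝ) ^ (d + 1) + 1) * Real.sqrt (w ⬝ᵥ w) := fun w => by
    rw [← Real.sqrt_mul (by positivity)]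
    exact Real.sqrt_le_sqrt (coordT_le_dot hR'L w)
  have hTE : ∀ w : ↥(R'.image (blk L)) ⊕ (↥(R'.image (blk L)) × NZ d L) → ℝ,
      Real.sqrt (T.mulVec w ⬝ᵥ M.mulVec (T.mulVec w)) = Real.sqrt ((L : ℝ) ^ (d + 1)) * Real.sqrt (w ⬝ᵥ (runB hR'L n a).mulVec w) := by
    intro w
    rw [← Real.sqrt_mul hLpow.le, hH, dot_congr_mulVec, hc, ← mul_assoc, mul_inv_cancel₀ hLpow.ne', one_mul]
  have s1 := Real.sqrt_nonneg (v ⬝ᵥ v)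
  have s2 := Real.sqrt_nonneg (v' ⬝ᵥ v')
  have sE := Real.sqrt_nonneg (v' ⬝ᵥ (runB hR'L n a).mulVec v')
  have sE' := Real.sqrt_nonneg (v ⬝ᵥ (runB hR'L n a).mulVec v)
  have sκ := Real.sqrt_nonneg (2 * (2 * ((d : ℝ) + 1) * (δ * L) ^ 2))
  have sC := Real.sqrt_nonneg ((L : ℝ) ^ (d + 1) + 1)
  have sL := Real.sqrt_nonneg ((L : ℝ) ^ (d + 1))
  have hκ2 : 0 ≤ 2 * ((d : ℝ) + 1) * (δ * L) ^ 2 + a * (Real.exp Θ - 1) := by nlinarith [mul_nonneg ha hexp, sq_nonneg (δ * L)]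
  -- substitute
  have t1 : Real.sqrt (T.mulVec v ⬝ᵥ T.mulVec v) * Real.sqrt (T.mulVec v' ⬝ᵥ M.mulVec (T.mulVec v')) ≤
      (Real.sqrt ((L : ℝ) ^ (d + 1) + 1) * Real.sqrt (v ⬝ᵥ v)) * (Real.sqrt ((L : ℝ) ^ (d + 1)) *
        Real.sqrt (v' ⬝ᵥ (runB hR'L n a).mulVec v')) := by
    rw [hTE v']; exact mul_le_mul_of_nonneg_right (hTn v) (by positivity)
  have t2 : Real.sqrt (T.mulVec v' ⬝ᵥ T.mulVec v') * Real.sqrt (T.mulVec v ⬝ᵥ M.mulVec (T.mulVec v)) ≤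
      (Real.sqrt ((L : ℝ) ^ (d + 1) + 1) * Real.sqrt (v' ⬝ᵥ v')) * (Real.sqrt ((L : ℝ) ^ (d + 1)) *
        Real.sqrt (v ⬝ᵥ (runB hR'L n a).mulVec v)) := by
    rw [hTE v]; exact mul_le_mul_of_nonneg_right (hTn v') (by positivity)
  have t3 : Real.sqrt (T.mulVec v ⬝ᵥ T.mulVec v) * Real.sqrt (T.mulVec v' ⬝ᵥ T.mulVec v') ≤
      (Real.sqrt ((L : ℝ) ^ (d + 1) + 1) * Real.sqrt (v ⬝ᵥ v)) * (Real.sqrt ((L : ℝ) ^ (d + 1) + 1) * Real.sqrt (v' ⬝ᵥ v')) :=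
    mul_le_mul (hTn v) (hTn v') (Real.sqrt_nonneg _) (by positivity)
  have hCC : Real.sqrt ((L : ℝ) ^ (d + 1) + 1) * Real.sqrt ((L : ℝ) ^ (d + 1) + 1) = (L : ℝ) ^ (d + 1) + 1 :=
    Real.mul_self_sqrt (by positivity)
  have hbig := hfine.trans (add_le_add (mul_le_mul_of_nonneg_left (add_le_add t1 t2) sκ) (mul_le_mul_of_nonneg_left t3 hκ2))
  refine (mul_le_mul_of_nonneg_left hbig hc0).trans (le_of_eq ?_)
  have e3 : Real.sqrt ((L : ℝ) ^ (d + 1) + 1) * Real.sqrt (v ⬝ᵥ v) * (Real.sqrt ((L : ℝ) ^ (d + 1) + 1) * Real.sqrt (v' ⬝ᵥ v')) =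
      ((L : ℝ) ^ (d + 1) + 1) * (Real.sqrt (v ⬝ᵥ v) * Real.sqrt (v' ⬝ᵥ v')) := by
    calc Real.sqrt ((L : ℝ) ^ (d + 1) + 1) * Real.sqrt (v ⬝ᵥ v) * (Real.sqrt ((L : ℝ) ^ (d + 1) + 1) * Real.sqrt (v' ⬝ᵥ v'))
        = (Real.sqrt ((L : ℝ) ^ (d + 1) + 1) * Real.sqrt ((L : ℝ) ^ (d + 1) + 1)) * (Real.sqrt (v ⬝ᵥ v) * Real.sqrt (v' ⬝ᵥ v')) := by
          ring
      _ = _ := by rw [hCC]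
  rw [e3]
  ring

end RunB

end Summit.QuantumFields.BalabanUV.T4Continuum.NE7K1LinRunBWeight
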